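import Literature.NumberTheory.Rogawski1990.FinExplicitTransferFactorLeviStratum

/-!
# R90 · S6 (Rogawski Ch. 14.1–5, stable trace formula) — W7-d (sequel): `Δ‴_v` on the HECKE-LEVEL diagonal stratum `ord_w d₀ ≠ 0`
# at an unramified inert place: `Δ‴_v(γ_H, γ₀) = (−1)^{m} q^{|m|}`, `m = ord_w d₀`

Helper for the S6 floor (E1-c) `R90.S6.StubR90ExtE1HeckeFL` (`Cruxes/H413/Lines/R90_S6_FloorE1D.lean`), closure DAG row E1.3.6.1
«transfer-factor and discriminant values on the DIAGONAL tori at an unramified inert `w` … explicit powers of `q` and the sign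
`μ_w(ϖ)^{val} = (−1)^{val}`», card W7-d of the S6 WAVE 7 menu (`R90/R90-szE1.1/g3/CLOSURE-E1.1.md` §3), sequel of
`Theorems/R90S6TransferFactorDiag.lean` (`transferFactor_diag_value`: `Δ‴_v = (−q)^{log v_w(χ_g(u)_w)}` on the regular diagonal torus);
consumed by E1.3.6.2 (the constant-term identity for the Hecke operators `𝟙_{K₀ t_m K₀}`, `m ≠ 0`).

THE MATHEMATICS [Rogawski1990 §4.9 p. 55]: `ι_v(γ_H) = diag(d₀, d₁, d₂) ∈ T ≤ U(Φ₃)(L⁺_v)` with the torus relations `σ(d₂)d₀ = σ(d₁)d₁ = σ(d₀)d₂ = 1`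
(★ `HeisRing.torus_relations`), read at the one place `w ∣ v` (`v_w ∘ σ_w = v_w`): `v_w(d₁) = 1`, `v_w(d₂) = v_w(d₀)⁻¹`.  If `m := ord_w d₀ ≠ 0`
(print's `t = d(a, b, ā⁻¹)` with `val(a) = m`, the support of the Satake parameter `χ_z(t) = z^{val(a)}`), then `γ` is REGULAR automatically
(the three valuations `q_w^{−m}, 1, q_w^{m}` are distinct) and `ord_w χ_g(u) = ord_w(d₁ − d₀) + ord_w(d₁ − d₂) = min(0, m) + min(0, −m) = −|m|`,
so `n₁₂ + n₂₃ = −|m|` and print's `Δ_{G∕H}(γ) = τ(γ) D_{G∕H}(γ) = (−1)^{n₁₂+n₂₃} q^{−(n₁₂+n₂₃)}` reads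
  `Δ‴_v(γ_H, γ₀) = (−q)^{|m|} = μ_w(ϖ)^{m} · q^{|m|}`  at EVERY `γ₀ ∈ U(H′)(L⁺_v)` matching `γ_H` (no `κ`-sign: one class, `κ_v = +1`).
(`D_{G∕H}(γ) = q^{|m|} > 1` off `T(𝒪_v)`: the `u`-root factors `|1 − u∕d₀|`, `|1 − d₂∕u|` of `|Π_{α∉H}(1 − α(γ))|_F^{1∕2}` are large.)

PROOF: the two ★ organs of the unit estate, ★ `finExplicitDelta_eq_neg_absNorm_zpow_mul_kappa_of_nonsplit_of_isUnramifiedIn` (`Δ‴_v = (−q)^{log v_w χ_g(u)_w} · κ_v`)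
and ★ `finKappaAt_eq_one_of_levi_of_nonsplit` (`κ_v = 1` on the regular diagonal stratum, no integrality), ★ `eval_finCharpolyTwo_eq_of_endoEmbLocal_eq`
(`χ_g(u) = (d₁ − d₀)(d₁ − d₂)`), and the valuation bookkeeping above (Mathlib `Valuation.map_sub_eq_of_lt_left∕right`, `WithZero.log_mul`, `WithZero.log_inv`).

Cell `hodgecm-mathlib`, crux H413 (`stmt-HodgeConjecture-24833`), route of record `HCCMUnconditional`; programme R90-TF (brief
`director/R90-BRIEF.v2.md`), section S6 (base `R90-C14`), seat R90-C14-p02 (g2), card W7-d (S6 dealer R90-C14-plan (g2) 2026-09-04T23:24:27Z).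
Lane `--supports stmt-HodgeConjecture-24833 --as helper`; ONE public theorem (+ private valuation lemmas), no definition, no `sorry`, no instance,
no notation.  INHABITED-AT-RAMIFIED: N∕A — inert (`c • w = w`) unramified `v` only.  HONEST LABEL: a helper theorem, count-neutral until the
E1.3.6.2 ∕ E1.3.9 assembly consumes it; HC_CM is proved only modulo the 7 printed citations (2 remaining named inputs: hLiu418 =
stmt-HodgeConjecture-24832, h413 = stmt-HodgeConjecture-24833) until rung 0 closes.

## References
* [Rogawski1990] J. D. Rogawski, *Automorphic Representations of Unitary Groups in Three Variables*, Ann. of Math. Stud. 123 (1990):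
  §4.9 p. 55 (`τ`, `D_{G∕H}`, `Δ_{G∕H} = τ D_{G∕H}`, Prop. 4.9.1 (b), «`χ_z(d(a, b, ā⁻¹)) = z^{val(a)}`»); §1.10 p. 9 (the diagonal torus);
  §3.6 pp. 28–29; §4.3 p. 43; §14.6 p. 242.
* [TateThesis1967] J. Tate, *Fourier analysis in number fields and Hecke's zeta-functions*, §2.5 (unramified quasi-characters).
-/

set_option autoImplicit false
-- the mandated namespace repeats the single-problem summit's segment (`HodgeConjecture.HodgeConjecture`)
set_option linter.dupNamespace false

noncomputable section

open NumberField IsDedekindDomain Matrix Polynomial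
open scoped MatrixGroups NNReal
open Literature.NumberTheory.Automorphic Literature.NumberTheory.Automorphic.UnitaryGroup
open Literature.NumberTheory.GaloisRepresentations
open Literature.NumberTheory.Rogawski1990

namespace Summit.HodgeConjecture.HodgeConjecture.R90.S6

/-! ## Valuation bookkeeping on the diagonal torus at the one place `w ∣ v` -/

section Torus

variable (L : Type) [Field L] [NumberField L] [IsCMField L] (v : HeightOneSpectrum (𝓞 ↥(maximalRealSubfield L)))
  (γH : (cmDatum L 2 (Matrix.of fun i j : Fin 2 => if i.val + j.val + 1 = 2 then (1 : L) else 0)).Local v ×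
    (cmDatum L 1 (Matrix.of fun i j : Fin 1 => if i.val + j.val + 1 = 1 then (1 : L) else 0)).Local v)
  {d : Fin 3 → (UnitaryGroup.LocalRing L v)ˣ}
  (hι : ((endoEmbLocal L v γH).val : GL (Fin 3) (UnitaryGroup.LocalRing L v)) = glDiagonal 3 (UnitaryGroup.LocalRing L v) d)
  (w : PlacesOver L v) (hw : IsCMField.complexConj L • w.1 = w.1)

/-- `x · x = 1` in `ℤₘ₀` forces `x = 1`. [folklore] -/
private theorem eq_one_of_mul_self_eq_one {x : WithZero (Multiplicative ℤ)} (h : x * x = 1) : x = 1 := by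
  have hx0 : x ≠ 0 := by
    rintro rfl
    rw [zero_mul] at h
    exact zero_ne_one h
  have hlog := congrArg WithZero.log h
  rw [WithZero.log_mul hx0 hx0, WithZero.log_one] at hlog
  rw [← WithZero.exp_log hx0, show WithZero.log x = 0 by omega, WithZero.exp_zero]

include hw in
/-- From a torus relation `σ(x) · y = 1` at a `c`-fixed place: `v_w(x_w) · v_w(y_w) = 1` (`v_w ∘ σ_w = v_w`, ★ `valued_galAdicCompletionMap`).
[cite: Rogawski1990, §1.10 p. 9] -/
private theorem valued_mul_valued_eq_one_of_conjLocal_mul {x y : UnitaryGroup.LocalRing L v}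
    (h : UnitaryGroup.conjLocal L (IsCMField.complexConj L) v x * y = 1) : Valued.v (x w) * Valued.v (y w) = 1 := by
  have h' : (UnitaryGroup.conjLocal L (IsCMField.complexConj L) v x * y) w = (1 : UnitaryGroup.LocalRing L v) w := by rw [h]
  rw [Pi.mul_apply, Pi.one_apply, conjLocal_apply_eq_galAdicCompletionMap L v w hw x] at h'
  have h'' := congrArg (fun z : w.1.adicCompletion L => Valued.v z) h'
  simp only [map_mul, valued_galAdicCompletionMap, map_one] at h''
  exact h''

include hι hw in
/-- **`v_w(d₁) = 1`** on the diagonal torus (`σ(d₁)d₁ = 1`). [cite: Rogawski1990, §1.10 p. 9; §4.9 p. 55] -/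
private theorem valued_d1_eq_one : Valued.v ((d 1 : UnitaryGroup.LocalRing L v) w) = 1 := by
  have ht := endoEmbLocal_mem_torusU_of_endoEmbLocal_eq L v γH hι
  obtain ⟨-, h11, -⟩ := HeisRing.torus_relations (conjLocal L (IsCMField.complexConj L) v) (cmLocalForm_eq_over L 3 v) ⟨_, ht⟩ hι.symm
  exact eq_one_of_mul_self_eq_one (valued_mul_valued_eq_one_of_conjLocal_mul L v w hw h11)

include hι hw in
/-- **`v_w(d₀) · v_w(d₂) = 1`** on the diagonal torus (`σ(d₀)d₂ = 1`). [cite: Rogawski1990, §1.10 p. 9; §4.9 p. 55] -/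
private theorem valued_d0_mul_valued_d2_eq_one :
    Valued.v ((d 0 : UnitaryGroup.LocalRing L v) w) * Valued.v ((d 2 : UnitaryGroup.LocalRing L v) w) = 1 := by
  have ht := endoEmbLocal_mem_torusU_of_endoEmbLocal_eq L v γH hι
  obtain ⟨-, -, h02⟩ := HeisRing.torus_relations (conjLocal L (IsCMField.complexConj L) v) (cmLocalForm_eq_over L 3 v) ⟨_, ht⟩ hι.symm
  exact valued_mul_valued_eq_one_of_conjLocal_mul L v w hw h02

omit [IsCMField L] in
/-- A unit of `∏_{w∣v} L_w` has non-zero valuation at `w`. [folklore] -/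
private theorem valued_ne_zero (i : Fin 3) : Valued.v ((d i : UnitaryGroup.LocalRing L v) w) ≠ 0 :=
  (Valuation.ne_zero_iff _).2 (Pi.isUnit_iff.1 (d i).isUnit w).ne_zero

include hι hw in
/-- **THE EXPONENT ON THE HECKE STRATUM: `log v_w(((d₁ − d₀)(d₁ − d₂))_w) = |log v_w(d₀,w)|`** when `v_w(d₀) ≠ 1` — i.e. `ord_w χ_g(u) = −|ord_w d₀|`
(`v_w(d₁) = 1`, `v_w(d₂) = v_w(d₀)⁻¹`; the ultrametric equality case on each factor). [cite: Rogawski1990, §4.9 p. 55] -/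
private theorem log_valued_weylNumerator_eq_natAbs (hm : Valued.v ((d 0 : UnitaryGroup.LocalRing L v) w) ≠ 1) :
    WithZero.log (Valued.v ((((d 1 : UnitaryGroup.LocalRing L v) - d 0) * ((d 1 : UnitaryGroup.LocalRing L v) - d 2)) w)) =
      ((WithZero.log (Valued.v ((d 0 : UnitaryGroup.LocalRing L v) w))).natAbs : ℤ) := by
  have h1 := valued_d1_eq_one L v γH hι w hw
  have h02 := valued_d0_mul_valued_d2_eq_one L v γH hι w hw
  have h0 := valued_ne_zero L v w (d := d) 0
  have h2' : Valued.v ((d 2 : UnitaryGroup.LocalRing L v) w) = (Valued.v ((d 0 : UnitaryGroup.LocalRing L v) w))⁻¹ :=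
    eq_inv_of_mul_eq_one_right h02
  rw [Pi.mul_apply, Pi.sub_apply, Pi.sub_apply, map_mul]
  rcases lt_or_gt_of_ne hm with hlt | hgt
  · -- `d₀ ∈ 𝔭_w`: `v(d₁ − d₀) = 1`, `v(d₁ − d₂) = v(d₂) = v(d₀)⁻¹`
    have hA : Valued.v ((d 1 : UnitaryGroup.LocalRing L v) w - (d 0 : UnitaryGroup.LocalRing L v) w) = 1 := by
      rw [Valuation.map_sub_eq_of_lt_left _ (by rw [h1]; exact hlt), h1]
    have hB : Valued.v ((d 1 : UnitaryGroup.LocalRing L v) w - (d 2 : UnitaryGroup.LocalRing L v) w) =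
        (Valued.v ((d 0 : UnitaryGroup.LocalRing L v) w))⁻¹ := by
      rw [Valuation.map_sub_eq_of_lt_right _ (by rw [h1, h2']; exact one_lt_inv_iff₀.2 ⟨zero_lt_iff.2 h0, hlt⟩), h2']
    rw [hA, hB, one_mul, WithZero.log_inv]
    have hneg : WithZero.log (Valued.v ((d 0 : UnitaryGroup.LocalRing L v) w)) < 0 := by
      rw [← WithZero.log_one]
      exact (WithZero.log_lt_log h0 one_ne_zero).2 hlt
    omega
  · -- `d₀⁻¹ ∈ 𝔭_w`: `v(d₁ − d₀) = v(d₀)`, `v(d₁ − d₂) = 1`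
    have hA : Valued.v ((d 1 : UnitaryGroup.LocalRing L v) w - (d 0 : UnitaryGroup.LocalRing L v) w) =
        Valued.v ((d 0 : UnitaryGroup.LocalRing L v) w) := by
      rw [Valuation.map_sub_eq_of_lt_right _ (by rw [h1]; exact hgt)]
    have hB : Valued.v ((d 1 : UnitaryGroup.LocalRing L v) w - (d 2 : UnitaryGroup.LocalRing L v) w) = 1 := by
      rw [Valuation.map_sub_eq_of_lt_left _ (by rw [h1, h2']; exact inv_lt_one_of_one_lt₀ hgt), h1]
    rw [hA, hB, mul_one]
    have hpos : 0 < WithZero.log (Valued.v ((d 0 : UnitaryGroup.LocalRing L v) w)) := by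
      rw [← WithZero.log_one]
      exact (WithZero.log_lt_log one_ne_zero h0).2 hgt
    omega

include hι hw in
/-- **REGULARITY IS AUTOMATIC ON THE HECKE STRATUM**: if `v_w(d₀) ≠ 1` then `dᵢ − dⱼ` (`i ≠ j`) are units of `∏_{w∣v} L_w` (one place `w` above the
non-split `v`; the valuations `v_w(d₀), 1, v_w(d₀)⁻¹` are pairwise distinct). [cite: Rogawski1990, §4.9 p. 55; §3.6 pp. 28–29] -/
private theorem isUnit_sub_of_valued_ne_one (hm : Valued.v ((d 0 : UnitaryGroup.LocalRing L v) w) ≠ 1) :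
    ∀ i j : Fin 3, i ≠ j → IsUnit ((d i : UnitaryGroup.LocalRing L v) - d j) := by
  have hc := IsCMField.complexConj_ne_one L
  have hvs : Subsingleton (PlacesOver L v) := PlacesOver.subsingleton_of_smul_eq (IsCMField.complexConj L) hc w hw
  have h1 := valued_d1_eq_one L v γH hι w hw
  have h02 := valued_d0_mul_valued_d2_eq_one L v γH hι w hw
  have h0 := valued_ne_zero L v w (d := d) 0
  have h2' : Valued.v ((d 2 : UnitaryGroup.LocalRing L v) w) = (Valued.v ((d 0 : UnitaryGroup.LocalRing L v) w))⁻¹ :=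
    eq_inv_of_mul_eq_one_right h02
  -- the three valuations are pairwise distinct
  have hv01 : Valued.v ((d 0 : UnitaryGroup.LocalRing L v) w) ≠ Valued.v ((d 1 : UnitaryGroup.LocalRing L v) w) := by
    rw [h1]; exact hm
  have hv12 : Valued.v ((d 1 : UnitaryGroup.LocalRing L v) w) ≠ Valued.v ((d 2 : UnitaryGroup.LocalRing L v) w) := by
    rw [h1, h2']; exact fun h => hm (inv_eq_one.1 h.symm)
  have hv02 : Valued.v ((d 0 : UnitaryGroup.LocalRing L v) w) ≠ Valued.v ((d 2 : UnitaryGroup.LocalRing L v) w) := by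
    rw [h2']
    intro h
    have hsq : Valued.v ((d 0 : UnitaryGroup.LocalRing L v) w) * Valued.v ((d 0 : UnitaryGroup.LocalRing L v) w) = 1 := by
      nth_rewrite 2 [h]
      exact mul_inv_cancel₀ h0
    exact hm (eq_one_of_mul_self_eq_one hsq)
  -- distinct valuations ⇒ distinct `w`-components ⇒ unit differences (one place)
  have hne : ∀ i j : Fin 3, i ≠ j → (d i : UnitaryGroup.LocalRing L v) w ≠ (d j : UnitaryGroup.LocalRing L v) w := by
    intro i j hij h
    have hv := congrArg (fun z : w.1.adicCompletion L => Valued.v z) h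
    fin_cases i <;> fin_cases j <;> first
      | exact absurd rfl hij
      | exact hv01 hv | exact hv01 hv.symm | exact hv12 hv | exact hv12 hv.symm | exact hv02 hv | exact hv02 hv.symm
  intro i j hij
  refine Pi.isUnit_iff.2 fun w' => ?_
  obtain rfl : w' = w := Subsingleton.elim w' w
  rw [Pi.sub_apply]
  exact isUnit_iff_ne_zero.2 (sub_ne_zero.2 (hne i j hij))

end Torus

/-- **ROGAWSKI'S EXPLICIT TRANSFER FACTOR ON THE HECKE-LEVEL DIAGONAL STRATUM AT AN UNRAMIFIED INERT PLACE: `Δ‴_v(γ_H, γ₀) = (−1)^{m} q^{|m|}`,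
`m = ord_w d₀ ≠ 0`.**  At a finite place `v` of `L⁺` non-split (`c • w = w`) and unramified in the CM field `L`, for `H′` hermitian with `det H′ ≠ 0` of
good reduction at `w`, `μ` unramified at `w` under the μ-guard `μ|_{𝕀_{L⁺}} = ω_{L∕L⁺}`, and `γ_H ∈ H_v` with `ι_v(γ_H) = diag(d₀, d₁, d₂)` OFF `T(𝒪_v)`
(`v_w(d₀) ≠ 1`, i.e. `m := ord_w d₀ ≠ 0`; regularity is then automatic): at EVERY `γ₀ ∈ U(H′)(L⁺_v)` matching `γ_H`,
`finExplicitDelta L v H′ γ_H μ γ₀ = (−#k_v)^{|log v_w(d₀,w)|}` — print's `Δ_{G∕H}(γ) = τ(γ) D_{G∕H}(γ)` with `τ = μ_w(ϖ)^{m} = (−1)^{m}` and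
`D_{G∕H} = q^{−(n₁₂+n₂₃)} = q^{|m|}`, the endoscopic sign being `+1` (one class).  Exponent as a natural number (`Int.natAbs`; Mathlib's
`Valued.v ϖ_w = exp(−1)`, so `log v_w(d₀,w) = −m`). [cite: Rogawski1990, §4.9 p. 55, Prop. 4.9.1 (b); §3.6 pp. 28–29; §4.3 p. 43; §14.6 p. 242]
[cite: TateThesis1967, §2.5] -/
theorem transferFactor_diag_value_of_valued_ne_one (L : Type) [Field L] [NumberField L] [IsCMField L]
    (H' : Matrix (Fin 3) (Fin 3) L) (hH' : (H'.map (IsCMField.complexConj L))ᵀ = H') (hH'd : IsUnit H'.det)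
    {v : HeightOneSpectrum (𝓞 ↥(maximalRealSubfield L))} (w : PlacesOver L v) (hw : IsCMField.complexConj L • w.1 = w.1)
    (hv : Algebra.IsUnramifiedIn (𝓞 L) v.asIdeal) (hH'w : IsUnit (placeForm H' w.1)) (hH'i : hH'w.unit ∈ glInt 3 (w.1.adicCompletion L))
    (μ : HeckeCharacter L) (hμ : μ.IsUnramifiedAt w.1)
    (hμω : ∀ x : ideleGroup ↥(maximalRealSubfield L), μ (AdeleRing.ideleBaseChange ↥(maximalRealSubfield L) L x) = quadraticHeckeCharCM L x)
    (γH : (cmDatum L 2 (Matrix.of fun i j : Fin 2 => if i.val + j.val + 1 = 2 then (1 : L) else 0)).Local v ×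
      (cmDatum L 1 (Matrix.of fun i j : Fin 1 => if i.val + j.val + 1 = 1 then (1 : L) else 0)).Local v)
    {d : Fin 3 → (UnitaryGroup.LocalRing L v)ˣ}
    (hι : ((endoEmbLocal L v γH).val : GL (Fin 3) (UnitaryGroup.LocalRing L v)) = glDiagonal 3 (UnitaryGroup.LocalRing L v) d)
    (hm : Valued.v ((d 0 : UnitaryGroup.LocalRing L v) w) ≠ 1)
    {γ₀ : (cmDatum L 3 H').Local v} (h₀ : IsLocalNormPair L H' v γH γ₀) :
    finExplicitDelta L v H' γH μ γ₀ =
      (-(Ideal.absNorm v.asIdeal : ℂ)) ^ (WithZero.log (Valued.v ((d 0 : UnitaryGroup.LocalRing L v) w))).natAbs := by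
  classical
  have hreg := isUnit_sub_of_valued_ne_one L v γH hι w hw hm
  -- `χ_g(u) = (d₁ − d₀)(d₁ − d₂)` is a unit by regularity
  have hχ : (finCharpolyTwo L v γH).eval (finGammaTwo L v γH) =
      ((d 1 : UnitaryGroup.LocalRing L v) - d 0) * ((d 1 : UnitaryGroup.LocalRing L v) - d 2) :=
    eval_finCharpolyTwo_eq_of_endoEmbLocal_eq L v γH hι
  have hu : IsUnit ((finCharpolyTwo L v γH).eval (finGammaTwo L v γH)) := by
    rw [hχ]
    exact (hreg 1 0 (by decide)).mul (hreg 1 2 (by decide))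
  rw [finExplicitDelta_eq_neg_absNorm_zpow_mul_kappa_of_nonsplit_of_isUnramifiedIn L v H' γH γ₀ w hw μ hμω hv hμ h₀ hu,
    finKappaAt_eq_one_of_levi_of_nonsplit L H' hH' hH'd w hw hv hH'w hH'i γH hι hreg h₀, hχ, Int.cast_one, mul_one,
    log_valued_weylNumerator_eq_natAbs L v γH hι w hw hm, zpow_natCast]

end Summit.HodgeConjecture.HodgeConjecture.R90.S6

end
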